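import Summits.HodgeConjecture.HodgeConjecture.Theorems.HeckePrymWeilHeckePrymAnchorsOfDeligneWeilFamilyDecl
import HarnessLib

/-!
# Line `Sketch` for crux `HeckePrymAnchors` (item stmt-HodgeConjecture-14496, route HeckePrymWeil) — lead skeleton, v23

Owned skeleton of the picked line (`Cruxes/HeckePrymAnchors/PICKED.md`), continuation lead
`prover-line-stmt-HodgeConjecture-14496-c37-0` (cycle c37, 2026-08-17). CODE UNCHANGED since v21
(c18): ONE stub, the ROUTE DECL `Summit.HodgeConjecture.HodgeConjecture.Theses.HeckePrymWeil.DeligneWeilFamily`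
(item stmt-HodgeConjecture-16866) BY NAME, and `HeckePrymAnchors_of :=
heckePrymAnchors_of_deligneWeilFamilyDecl stub_deligneWeilFamily` (p129064) concludes the crux by
name; the moment item 16866 is proved and `DeligneWeilFamily_holds` is appended to the route file the
sorry below is replaced by that term and this file lands as `Theorems/HeckePrymWeilHeckePrymAnchors.lean`.

NEW IN c37 (v23) — THE PERIOD-FREE RESIDUAL. `Theorems/HeckePrymWeilHeckePrymAnchorsOfCMAnchoredFamily`
(p144675, `--supports`, registered sub-goal `heckePrymAnchors_of_cmAnchoredFamily`) proves
`heckePrymAnchors_of_cmAnchoredFamily : [U_alg] → HeckePrymAnchors`, where [U_alg] asks, for every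
BALANCED `(X, Φ)` only, for an algebraic smooth projective Weil-type family through `X` over a smooth
irreducible quasi-projective base (closed in `ℙᴺ × S`, global `√-p`, abelian charts), integral
level-`n' ≥ 3` monodromy at the base point, and ONE fibre `(Y, Ψ)` with a rational `Ψ^*`-linear
idempotent `Pr` of `H¹(Y(ℂ); ℂ)`, `im Pr ∩ V_{i√p} ⊂ H^{0,1}`, `ker Pr ∩ V_{i√p} ⊂ H^{1,0}` (a CM-split
fibre). No Weil datum, period domain, period surjectivity, tensor isogeny or Riemann theorem is left in
the hypothesis: [U] ⟹ [U_alg] is c34's own first half (the fibre over `J_R`; landed as the sandwich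
certificate `cmAnchoredFamily_of_periodConstruction`, p146537, same file), [U_alg] ⟹ crux is p144675; so
[U_alg] is what ANY constructor of item 16866 owes this crux (when it lands as a theorem `that`:
`HeckePrymAnchors_of := heckePrymAnchors_of_cmAnchoredFamily that`).

NEW IN c34 (v22) — A SECOND, STRICTLY CHEAPER CLOSURE IS LANDED. The residual of item 16866 in the tree
is [U] ∧ [F]: Deligne's period construction (hypothesis `h` of
`HodgeTheory/WeilFamilyLevelStructureOfPeriodConstruction.deligne1982_weilFamily_levelStructure_of_periodConstruction`:
level-`n′` PEL family over `Γ\X⁺` through every `(P, ψ₀)` with charts, integral level monodromy and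
period surjectivity) and Riemann's theorem / fullness of `H¹` (hypothesis `hF`). [F] serves ONLY the
tensor-isogeny clause (b) of 16866, which this crux consumes only through
`weilClassesOf Y Ψ k p ≤ algebraicClasses Y.X k` at the special fibre. c34 proves that inequality at
the fibre over the rational diagonal CM point `J_R` DIRECTLY — Lefschetz `(1,1)` on that fibre (the
tree's discharged `lefschetzOneOne_rational_holds`) applied to the rational `(1,1)`-classes
`p·(x ∪ y) - Ψ^*x ∪ Ψ^*y`, `Ψ^*x ∪ y + x ∪ Ψ^*y` (`x ∈ P`, `y ∈ N`, `H¹ = P ⊕ N`), then Kleiman moving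
on the abelian variety — and lands (all `--supports` this item, namespace `…Theorems.HeckePrymWeilLine`):
* `Theorems/HeckePrymWeilHeckePrymAnchorsOfAlgebraicAnchor` (p139328): `heckePrymAnchors_of_kActionAlg`
  (algebraic-anchor form of the kAction → globalAction → hodgeWeilSection → crux pipeline);
* `Theorems/HeckePrymWeilHeckePrymAnchorsCMAnchorDivisors` (p139853), `…CMAnchorWeilLine` (p140526):
  KEY LEMMA `cm_weilClassesOf_le_algebraicClasses` (strong Weil plane algebraic at a CM projector);
* `Theorems/HeckePrymWeilHeckePrymAnchorsCMProjector` (p140521): `cm_projector_of_periodPoint`;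
* `Theorems/HeckePrymWeilHeckePrymAnchorsOfPeriodConstruction` (p140954):
  `kActionAlg_of_periodConstruction : [U] → (algebraic-anchor form)`;
* `Theorems/HeckePrymWeilHeckePrymAnchorsOfPeriodConstructionCrux` (p141474):
  `kActionAlg_of_kAction : deligne1982_weilFamily_kAction → (algebraic-anchor form)` and
  **`heckePrymAnchors_of_periodConstruction : [U] → HeckePrymAnchors`** — the crux ⇐ [U] ALONE.
So this crux closes the moment ANY of {item 16866 `DeligneWeilFamily`, the hypothesis [U] as a
theorem, `deligne1982_weilFamily_levelStructure` / `_kAction` / `_globalAction`, WFR /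
`weilFamily_hyperbolic_weilSystem_reach`} is proved, and the algebraic-anchor form (hypothesis of
`heckePrymAnchors_of_kActionAlg`) is the common weakening of all of them; the by-name stub below stays
the registered one because any proof of 16866 closes it, while [U] is one rendering of the construction
(when [U] lands first: `HeckePrymAnchors_of := heckePrymAnchors_of_periodConstruction ‹[U]›`).

* `stub_deligneWeilFamily : DeligneWeilFamily` = route item stmt-HodgeConjecture-16866 (crux, rank 5;
  Deligne LNM 900, proof of Thm. 4.8; residual = [U] (XL apex: the algebraic family over `Γ\X⁺`,
  Baily–Borel/Borel, MFK Thm. 7.9) ∧ [F] (fullness, `HodgeTheory/AbelianVarietyHodgeHomFullness`);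
  for THIS crux [U] suffices, see above). THE remaining blocker, staffed as its own crux item.

History v1–v21: leads -0, c1–c33 (p86420 … p129064, see `Cruxes/HeckePrymAnchors/NOTES.md`).
`HeckePrymAnchors_of` concludes the crux BY NAME.
-/

noncomputable section

-- every declaration of this problem lives in `Summit.HodgeConjecture.HodgeConjecture.…` (summit = sub-problem)
set_option linter.dupNamespace false

namespace Summit.HodgeConjecture.HodgeConjecture.Theorems.HeckePrymWeilLine

open Summit.HodgeConjecture.HodgeConjecture.Theses.HeckePrymWeil

/-! ## The stub (the ONLY sorry of this file): the route decl of item stmt-HodgeConjecture-16866, by name -/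

/-- STUB F — ROUTE ITEM `DeligneWeilFamily` (stmt-HodgeConjecture-16866), BY NAME: Deligne's abelian
scheme with `𝒪_K`-action through the balanced `(X, Φ)` over a smooth irreducible quasi-projective
base, embedded in `ℙᴺ × S`, a global `g` (the `√-p`), a chart `e : X ≅ 𝒳_{s₁}` intertwining `Φ`
and `g`, abelian charts at every point, ONE global class `W` with `W|_{s₁} = e^{-1*}c`, and a fibre
`K`-isogenous to the tensor point `(A₁ × A₁, (x,y) ↦ (-p·y, x))`. Replace by `DeligneWeilFamily_holds`
when item 16866 closes. [cite: Deligne1982HodgeCycles, proof of Thm. 4.8 (pp. 47–51)] -/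
theorem stub_deligneWeilFamily :
    Summit.HodgeConjecture.HodgeConjecture.Theses.HeckePrymWeil.DeligneWeilFamily := by
  sorry

/-! ## Glue: the stub concludes the crux BY NAME (everything else is landed or discharged) -/

/-- **The line closes the crux**: `HeckePrymAnchors` from the one stub, by the landed by-name edge
`heckePrymAnchors_of_deligneWeilFamilyDecl : DeligneWeilFamily → HeckePrymAnchors` (p129064, c18; =
`heckePrymAnchors_of_deligneWeilFamily` p127207 after unfolding the decl: global class ⇒ continuous
section `globalSection` ⇒ `deligne1982_weilFamily_kAction`; charts ⇒ balanced fibres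
`deligne1982_weilFamily_globalAction_of_kAction`; aimed companion surface, Deligne-1968 engine
discharged, isogeny transfer and chart; unbalanced `A` anchors only `0`). When item 16866 closes:
`HeckePrymAnchors_of := heckePrymAnchors_of_deligneWeilFamilyDecl DeligneWeilFamily_holds`. -/
theorem HeckePrymAnchors_of : HeckePrymAnchors :=
  heckePrymAnchors_of_deligneWeilFamilyDecl stub_deligneWeilFamily

end Summit.HodgeConjecture.HodgeConjecture.Theorems.HeckePrymWeilLine

end
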